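import Literature.Analysis.FluidPDE.NSUniqueness2DParts
import Literature.Analysis.FluidPDE.NSUniqueness2DL4
import HarnessLib

/-!
# Discharge of `ladyzhenskaya_torus2`

Analysis/FluidPDE discharge file: the named input `Literature.Analysis.FluidPDE.ladyzhenskaya_torus2`
of the Lions–Prodi assembly `lions_prodi_uniqueness_torus2_of_parts` (`NSUniqueness2DParts`;
Kuksin–Shirikyan 2012, Example 1.1.5 (1.8)) follows from the tree's Ladyzhenskaya inequality for
`L²` fields with finite spectral dissipation, `exists_ladyzhenskaya_const_memLp`
(`NSUniqueness2DL4`, built on the smooth-field inequality `Torus.exists_ladyzhenskaya_const` of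
`FunctionSpaces/TorusLadyzhenskaya`), once the two spectral quantities are compared:
`∫⁻ ‖w‖² + eGradNormSq w ≤ 4π² · eSobolevNorm 1 (complexify ∘ w)²`
(`= 4π² ∑ₖ (1 + |k|²) |ŵ(k)|²`, Parseval and `1 ≤ 4π²`).

* `Torus.lintegral_add_eGradNormSq_le_eSobolevNorm_sq` — the comparison;
* `ladyzhenskaya_torus2_holds` — the discharge.
-/

open MeasureTheory Set Filter Topology UnitAddTorus
open scoped ENNReal NNReal InnerProductSpace

noncomputable section

namespace Literature.Analysis.FluidPDE

open FunctionSpaces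

variable {d : Type*} [Fintype d]

/-- **`∫⁻ ‖w‖² + eGradNormSq w ≤ 4π² ‖w‖²_{H¹}`** for `w ∈ L²(T^d; ℝ^d)`, the `H¹` norm being the
spectral `Torus.eSobolevNorm 1` of the complexified field: termwise
`(1 + 4π²|k|²)|ŵ(k)|² ≤ 4π²(1 + |k|²)|ŵ(k)|²` and Parseval. [folklore] -/
theorem Torus.lintegral_add_eGradNormSq_le_eSobolevNorm_sq {w : UnitAddTorus d → EuclideanSpace ℝ d}
    (hw : MemLp w 2 volume) :
    (∫⁻ x, ‖w x‖ₑ ^ 2) + Torus.eGradNormSq w ≤ ENNReal.ofReal (4 * Real.pi ^ 2) *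
      Torus.eSobolevNorm 1 (EuclideanSpace.complexify ∘ w) ^ 2 := by
  have hπ : (1 : ℝ≥0∞) ≤ ENNReal.ofReal (4 * Real.pi ^ 2) := by
    rw [← ENNReal.ofReal_one]
    exact ENNReal.ofReal_le_ofReal (by nlinarith [Real.pi_gt_three])
  -- unfold the `H¹` norm
  have hsob : Torus.eSobolevNorm 1 (EuclideanSpace.complexify ∘ w) ^ 2 =
      ∑' k : d → ℤ, ENNReal.ofReal (1 + Torus.freqNormSq k) *
        ‖mFourierCoeff (EuclideanSpace.complexify ∘ w) k‖ₑ ^ 2 := by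
    rw [Torus.eSobolevNorm, ← ENNReal.rpow_natCast _ 2, ← ENNReal.rpow_mul]
    norm_num
    refine tsum_congr fun k => ?_
    rw [Torus.sobolevWeight, ← Real.rpow_natCast _ 2, ← Real.rpow_mul (by have := Torus.freqNormSq_nonneg k; linarith)]
    norm_num
  rw [hsob, ← Torus.tsum_enorm_sq_mFourierCoeff_complexify hw, Torus.eGradNormSq_eq_tsum, ← ENNReal.tsum_mul_left,
    ← ENNReal.tsum_add, ← ENNReal.tsum_mul_left]
  refine ENNReal.tsum_le_tsum fun k => ?_
  set a := ‖mFourierCoeff (EuclideanSpace.complexify ∘ w) k‖ₑ ^ 2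
  have hk : 0 ≤ Torus.freqNormSq k := Torus.freqNormSq_nonneg k
  calc a + ENNReal.ofReal (4 * Real.pi ^ 2) * (ENNReal.ofReal (Torus.freqNormSq k) * a)
      ≤ ENNReal.ofReal (4 * Real.pi ^ 2) * a +
          ENNReal.ofReal (4 * Real.pi ^ 2) * (ENNReal.ofReal (Torus.freqNormSq k) * a) := by
        gcongr
        calc a = 1 * a := (one_mul a).symm
          _ ≤ ENNReal.ofReal (4 * Real.pi ^ 2) * a := by gcongr
    _ = ENNReal.ofReal (4 * Real.pi ^ 2) * (ENNReal.ofReal (1 + Torus.freqNormSq k) * a) := by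
        rw [ENNReal.ofReal_add zero_le_one hk, ENNReal.ofReal_one]; ring

/-- **Discharge of `ladyzhenskaya_torus2`** (Kuksin–Shirikyan 2012, Example 1.1.5 (1.8)): from
`exists_ladyzhenskaya_const_memLp` (`∫⁻ ‖w‖⁴ ≤ C (∫⁻‖w‖²)(∫⁻‖w‖² + eGradNormSq w)`) and the
comparison `Torus.lintegral_add_eGradNormSq_le_eSobolevNorm_sq`, with constant `4π² C`. [cite: KuksinShirikyan2012, Example 1.1.5 (1.8)] -/
theorem ladyzhenskaya_torus2_holds : ladyzhenskaya_torus2 := by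
  obtain ⟨C, hC, hLad⟩ := exists_ladyzhenskaya_const_memLp
  refine ⟨C.toNNReal * (4 * Real.pi ^ 2).toNNReal, fun w hw => ?_⟩
  refine (hLad w hw).trans ?_
  have h := Torus.lintegral_add_eGradNormSq_le_eSobolevNorm_sq hw
  have hC' : ((C.toNNReal * (4 * Real.pi ^ 2).toNNReal : ℝ≥0) : ℝ≥0∞) = C * ENNReal.ofReal (4 * Real.pi ^ 2) := by
    rw [ENNReal.coe_mul, ENNReal.coe_toNNReal hC, ENNReal.ofReal]
  rw [hC']
  calc C * ((∫⁻ x, ‖w x‖ₑ ^ 2) * ((∫⁻ x, ‖w x‖ₑ ^ 2) + Torus.eGradNormSq w))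
      ≤ C * ((∫⁻ x, ‖w x‖ₑ ^ 2) * (ENNReal.ofReal (4 * Real.pi ^ 2) *
          Torus.eSobolevNorm 1 (EuclideanSpace.complexify ∘ w) ^ 2)) := by gcongr
    _ = C * ENNReal.ofReal (4 * Real.pi ^ 2) * (∫⁻ x, ‖w x‖ₑ ^ 2) *
          Torus.eSobolevNorm 1 (EuclideanSpace.complexify ∘ w) ^ 2 := by ring

end Literature.Analysis.FluidPDE

end
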